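import Mathlib
import Literature.AlgebraicGeometry.Resolution.FormalShear
import Summits.ResolutionOfSingularities.ResolutionOfSingularities.Theorems.WeightedInvariantLocalWeightedDropMonicDescentLabels

/-!
# `WeightedInvariant.LocalWeightedDrop`, sub-stub N4″: the `u₂`-shear keeps the leftmost column (piece L3 of the N4″ plan = CJS Lemma 13.6)

Crux item stmt-ResolutionOfSingularities-8899 `LocalWeightedDrop` (route `ResolutionOfSingularities/WeightedInvariant`), door
`WeightedConstruction` stmt-ResolutionOfSingularities-0571.  [OURS · L1 W4.3, chain w43, lead prover; piece L3 of `N4PRIME-PLAN.md`.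
MODEL: Cossart–Jannsen–Saito LNM 2270 Lemma 13.6 ("`ũ₂ = u₂ − φu₁` … the vertices on the line `{a₁ = α}` together with the initial
forms at it are not affected"); here for one series `A ∈ k[[u₁,u₂]]` and the shear `MonicDescent.shear h A = A(u₁, u₂ + u₁h)`, any `h`.]

* `MonicDescent.X_dvd_shear_sub` — `u₁ ∣ A(u₁, u₂ + u₁h) − A` (kill `u₁`: both sides become `A(0, u₂)`);
* `MonicDescent.coeff_shear_of_le` — if every exponent of `A` has first coordinate `≥ a`, then in the columns `d₀ ≤ a` the shear
  changes nothing: `coeff d (shear h A) = coeff d A`.  Consequently the leftmost column of the scaled Newton set of a label, the lex-min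
  vertex `(α, β)`, its monomial and its oddness are the same for `(A₀, A₁)` and `(shear h A₀, shear h A₁)` (used at every `(1:λ)` point
  move and for the limit label of the tail argument).
-/

set_option linter.dupNamespace false -- mandated namespace of this single-conjunct summit

noncomputable section

namespace Summit.ResolutionOfSingularities.ResolutionOfSingularities.Theorems

namespace MonicDescent

open MvPowerSeries Literature.AlgebraicGeometry.Resolution

variable {k : Type} [Field k]

/-- The shear family as a `![…]` vector (to use `FormalShear`). -/
theorem shearFamily_eq (h : MvPowerSeries (Fin 2) k) :
    (fun i : Fin 2 => if i = 0 then (X 0 : MvPowerSeries (Fin 2) k) else X 1 + X 0 * h) = ![X 0, X 1 + X 0 * h] := by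
  funext i
  fin_cases i <;> rfl

/-- Unfolding of `shear` with the `![…]` family. -/
theorem shear_eq (h A : MvPowerSeries (Fin 2) k) : shear h A = subst ![X 0, X 1 + X 0 * h] A := by
  rw [shear, shearFamily_eq]

/-- The shear family has zero constant terms. -/
theorem constantCoeff_shearFamily (h : MvPowerSeries (Fin 2) k) :
    ∀ i, constantCoeff (![X 0, X 1 + X 0 * h] i : MvPowerSeries (Fin 2) k) = 0 :=
  FormalShear.constantCoeff_shear (by rw [map_mul, constantCoeff_X, zero_mul])

/-- COEFFICIENTS AFTER KILLING `u₁` (`u₁ ↦ 0`, `u₂ ↦ u₂`): monomials free of `u₁` survive, the others die. -/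
theorem coeff_killOne (g : MvPowerSeries (Fin 2) k) (e : Fin 2 →₀ ℕ) :
    coeff e (subst ![(0 : MvPowerSeries (Fin 2) k), X 1] g) = if e 0 = 0 then coeff e g else 0 := by
  classical
  have ha : HasSubst ![(0 : MvPowerSeries (Fin 2) k), X 1] :=
    hasSubst_of_constantCoeff_zero fun i => by fin_cases i <;> simp [constantCoeff_X]
  rw [coeff_subst ha]
  have hprod : ∀ d : Fin 2 →₀ ℕ,
      (d.prod fun s m => (![(0 : MvPowerSeries (Fin 2) k), X 1] s) ^ m) =
        (0 : MvPowerSeries (Fin 2) k) ^ (d 0) * X 1 ^ (d 1) := by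
    intro d
    rw [Finsupp.prod_fintype _ _ (fun i => pow_zero _), Fin.prod_univ_two]
    rfl
  have hsingle : ∀ d : Fin 2 →₀ ℕ, d 0 = 0 → d = Finsupp.single 1 (d 1) := by
    intro d hd
    ext i
    fin_cases i
    · simpa using hd
    · simp
  simp_rw [hprod]
  by_cases he : e 0 = 0
  · rw [if_pos he, finsum_eq_single _ e]
    · rw [he, pow_zero, one_mul, coeff_X_pow, if_pos (hsingle e he), smul_eq_mul, mul_one]
    · intro d hd
      by_cases hd0 : d 0 = 0
      · rw [hd0, pow_zero, one_mul, coeff_X_pow, if_neg, smul_zero]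
        intro h'
        apply hd
        rw [hsingle d hd0, hsingle e he, h']
        simp
      · rw [zero_pow hd0, zero_mul, map_zero, smul_zero]
  · rw [if_neg he]
    apply finsum_eq_zero_of_forall_eq_zero
    intro d
    by_cases hd0 : d 0 = 0
    · rw [hd0, pow_zero, one_mul, coeff_X_pow, if_neg, smul_zero]
      intro h'
      apply he
      rw [h']
      simp
    · rw [zero_pow hd0, zero_mul, map_zero, smul_zero]

/-- Killing `u₁` after the shear is killing `u₁`: `A(0, u₂ + 0·h) = A(0, u₂)`. -/
theorem killOne_shear (h A : MvPowerSeries (Fin 2) k) :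
    subst ![(0 : MvPowerSeries (Fin 2) k), X 1] (shear h A) = subst ![(0 : MvPowerSeries (Fin 2) k), X 1] A := by
  have hκ : HasSubst ![(0 : MvPowerSeries (Fin 2) k), X 1] :=
    hasSubst_of_constantCoeff_zero fun i => by fin_cases i <;> simp [constantCoeff_X]
  have hσ : HasSubst ![X 0, X 1 + X 0 * h] := hasSubst_of_constantCoeff_zero (constantCoeff_shearFamily h)
  rw [shear_eq, subst_comp_subst_apply hσ hκ]
  congr 1
  funext s
  fin_cases s
  · show subst ![(0 : MvPowerSeries (Fin 2) k), X 1] (X 0) = 0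
    rw [subst_X hκ]
    rfl
  · show subst ![(0 : MvPowerSeries (Fin 2) k), X 1] (X 1 + X 0 * h) = X 1
    rw [subst_add hκ, subst_mul hκ, subst_X hκ, subst_X hκ]
    simp

/-- The shear changes a series by a multiple of `u₁`: `u₁ ∣ A(u₁, u₂ + u₁h) − A`. -/
theorem X_dvd_shear_sub (h A : MvPowerSeries (Fin 2) k) : X 0 ∣ shear h A - A := by
  rw [X_dvd_iff]
  intro m hm
  have hk := congrArg (coeff m) (killOne_shear h A)
  rw [coeff_killOne, coeff_killOne, if_pos hm, if_pos hm] at hk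
  rw [map_sub, hk, sub_self]

/-- The shear fixes `u₁`. -/
theorem shear_X_zero (h : MvPowerSeries (Fin 2) k) : shear h (X 0) = X 0 := by
  rw [shear_eq, subst_X (hasSubst_of_constantCoeff_zero (constantCoeff_shearFamily h))]
  rfl

/-- The shear is multiplicative. -/
theorem shear_mul (h A B : MvPowerSeries (Fin 2) k) : shear h (A * B) = shear h A * shear h B := by
  rw [shear_eq, shear_eq, shear_eq, subst_mul (hasSubst_of_constantCoeff_zero (constantCoeff_shearFamily h))]

/-- The shear of a power of `u₁` times `B`. -/
theorem shear_X_pow_mul (h B : MvPowerSeries (Fin 2) k) (a : ℕ) : shear h (X 0 ^ a * B) = X 0 ^ a * shear h B := by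
  rw [shear_mul, shear_eq h (X 0 ^ a), subst_pow (hasSubst_of_constantCoeff_zero (constantCoeff_shearFamily h)),
    ← shear_eq, shear_X_zero]

/-- THE `u₂`-SHEAR KEEPS THE LEFTMOST COLUMN (CJS Lemma 13.6 for one series): if every exponent of `A` has first coordinate `≥ a`,
then `A(u₁, u₂ + u₁h)` and `A` have the same coefficients at all exponents with first coordinate `≤ a` (in particular no exponent with
first coordinate `< a` appears, and the column `a` is untouched). -/
theorem coeff_shear_of_le (h A : MvPowerSeries (Fin 2) k) (a : ℕ) (hA : ∀ e : Fin 2 →₀ ℕ, coeff e A ≠ 0 → a ≤ e 0)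
    (d : Fin 2 →₀ ℕ) (hd : d 0 ≤ a) : coeff d (shear h A) = coeff d A := by
  -- `A = u₁^a · B`
  have hdvd : X 0 ^ a ∣ A := by
    rw [X_pow_dvd_iff]
    intro m hm
    by_contra hne
    exact absurd (hA m hne) (not_le.mpr hm)
  obtain ⟨B, rfl⟩ := hdvd
  -- `shear (u₁^a B) - u₁^a B = u₁^a (shear B - B) = u₁^(a+1) · C`
  obtain ⟨C, hC⟩ := X_dvd_shear_sub h B
  have hdiff : shear h (X 0 ^ a * B) - X 0 ^ a * B = X 0 ^ (a + 1) * C := by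
    rw [shear_X_pow_mul, ← mul_sub, hC, pow_succ, mul_assoc]
  have hzero : coeff d (X 0 ^ (a + 1) * C) = 0 :=
    (X_pow_dvd_iff.mp (Dvd.intro C rfl)) d (by omega)
  have := congrArg (coeff d) hdiff
  rw [map_sub, hzero, sub_eq_zero] at this
  exact this

/-- Column version for a PAIR read through the scaled Newton set: if every point of `newtonSet A₀ A₁` has first coordinate `≥ a`
(i.e. `a ≤ 2α`), then the sheared label `(shear h A₀, shear h A₁)` has the same `A₀`-coefficients at exponents `d` with `d₀ ≤ a` and the
same `A₁`-coefficients at exponents `d` with `2d₀ ≤ a`: the scaled Newton sets agree on all columns `≤ a` (CJS Lemma 13.6: the line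
`P₀ = 2α`, hence `(α, β)` and the oddness of the lex-min vertex, survive the change `ũ₂ = u₂ + u₁h`). -/
theorem coeff_shear_pair_of_le (h A₀ A₁ : MvPowerSeries (Fin 2) k) (a : ℕ)
    (hN : ∀ P ∈ newtonSet A₀ A₁, a ≤ P 0) :
    (∀ d : Fin 2 →₀ ℕ, d 0 ≤ a → coeff d (shear h A₀) = coeff d A₀) ∧
    (∀ d : Fin 2 →₀ ℕ, 2 * d 0 ≤ a → coeff d (shear h A₁) = coeff d A₁) := by
  refine ⟨fun d hd => coeff_shear_of_le h A₀ a (fun e he => hN e (Or.inl he)) d hd, fun d hd => ?_⟩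
  refine coeff_shear_of_le h A₁ (d 0) (fun e he => ?_) d le_rfl
  have h2 : a ≤ (2 • e) 0 := hN (2 • e) (Or.inr ⟨e, rfl, he⟩)
  rw [Finsupp.smul_apply, smul_eq_mul] at h2
  omega

end MonicDescent

end Summit.ResolutionOfSingularities.ResolutionOfSingularities.Theorems

end
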